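import Summits.Ventures.PercRepro.Night2LocalD2R14LargeCoColoop

/-!
# PercRepro — the large shadow sets of the coloop cell: at most three pair preimages from `|S| ≥ 9` (night-2, gen 16)

At a shadow set `S` with `|S| ≥ 9` of the coloop cell (simple matroid) there are at most three pair preimages
(`card_pairPre_le_three_of_nine_le`, proofs/NIGHT-2-k1.md §6 (G4)): four pair preimages `B₁, …, B₄` with pair sets
`Xᵢ = S ∖ Bᵢ` would all contain the rank-`3` flat `Λ = cl (S ∖ (X₁ ∪ X₂ ∪ X₃))` (every `cl Bᵢ ∩ cl Bⱼ` has rank `≤ 3` and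
contains a rank-`3` subset of `Λ`, hence equals `Λ`), so every `Xᵢ` lies in `T = S ∖ Λ` and `T ⊆ Xᵢ ∪ Xⱼ` for all
`i ≠ j` — impossible for four distinct 2-sets (`|T| ≤ 4`: with `|T| = 4` the complements coincide, with `|T| = 3` the
four complementary points are distinct, with `|T| = 2` the sets coincide).
-/

namespace PercRepro.Shadow

open Finset PerFlat ThmH

variable {α : Type*} [DecidableEq α] {M : Matroid α} [M.Finite]

omit [DecidableEq α] in
/-- `X ⊆ cl Y` gives `cl X ⊆ cl Y`. -/
theorem clF_subset_clF_of_subset_clF {X Y : Finset α} (h : X ⊆ clF M Y) : clF M X ⊆ clF M Y := by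
  intro e he
  rw [mem_clF_iff] at he ⊢
  have h' : (X : Set α) ⊆ M.closure (Y : Set α) := by
    intro x hx
    rw [← coe_clF]
    exact Finset.mem_coe.2 (h (Finset.mem_coe.1 hx))
  have := M.closure_subset_closure h'
  rw [M.closure_closure] at this
  exact this he

open scoped Classical in
/-- For distinct pair preimages `B ≠ B'` of `S` and a set `R ⊆ B ∩ B'` of rank `≥ 3`: `cl B ∩ cl B' ⊆ cl R`. -/
theorem clF_inter_subset_clF_of_three_le {G : Finset α} (hG : G ∈ flatsQ M (4 + 1)) {S B B' : Finset α}
    (hB : B ∈ pairPre M 4 G S) (hB' : B' ∈ pairPre M 4 G S) (hne : B ≠ B') {R : Finset α} (hRB : R ⊆ B)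
    (hRB' : R ⊆ B') (hR : 3 ≤ rkN M R) : clF M B ∩ clF M B' ⊆ clF M R := by
  have hGg : G ⊆ gr M := (mem_flatsQ.1 hG).1
  have hUB : B ∈ Uq M (4 + 2) 4 := (mem_membersIn.1 (mem_pairPre.1 hB).1).1
  have hUB' : B' ∈ Uq M (4 + 2) 4 := (mem_membersIn.1 (mem_pairPre.1 hB').1).1
  have hI : clF M B ∩ clF M B' ⊆ gr M :=
    Finset.inter_subset_left.trans ((mem_membersIn.1 (mem_pairPre.1 hB).1).2.trans hGg)
  have hRI : R ⊆ clF M B ∩ clF M B' :=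
    Finset.subset_inter (hRB.trans (subset_clF hUB)) (hRB'.trans (subset_clF hUB'))
  have hle := rkN_inter_clF_le_three_of_pairPre hG hB hB' hne
  have hge := rkN_mono (M := M) hRI
  have heq : rkN M R = rkN M (clF M B ∩ clF M B') := by omega
  have := subset_closure_of_rkN_eq (M := M) hI hRI heq
  intro e he
  rw [mem_clF_iff]
  exact this (Finset.mem_coe.2 he)

open scoped Classical in
/-- The points of `S` outside three pair sets form a set of rank `≥ 3` once `|S| ≥ 9`. -/
theorem three_le_rkN_sdiff_three {G : Finset α} (hG : G ∈ flatsQ M (4 + 1))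
    (hsimple : ∀ e ∈ gr M, ∀ f ∈ gr M, e ≠ f → rkN M {e, f} = 2) {y : α} (hyG : y ∈ G)
    (hyc : y ∉ clF M (G.erase y)) {S : Finset α} (hS : S ∈ shadowAt M (4 + 2) 4 (Uq M (4 + 2) 4) G)
    (h9 : 9 ≤ S.card) {B₁ B₂ B₃ : Finset α} (h₁ : B₁ ∈ pairPre M 4 G S) (h₂ : B₂ ∈ pairPre M 4 G S)
    (h₃ : B₃ ∈ pairPre M 4 G S) : 3 ≤ rkN M (S \ ((S \ B₁) ∪ (S \ B₂) ∪ (S \ B₃))) := by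
  have hGg : G ⊆ gr M := (mem_flatsQ.1 hG).1
  have hSG : S ⊆ G := subset_of_mem_shadowAt hS
  set R := S \ ((S \ B₁) ∪ (S \ B₂) ∪ (S \ B₃)) with hRdef
  have hyR : y ∈ R := by
    rw [hRdef, Finset.mem_sdiff, Finset.mem_union, Finset.mem_union, Finset.mem_sdiff, Finset.mem_sdiff,
      Finset.mem_sdiff]
    have hyS : y ∈ S := mem_of_mem_shadowAt_of_coloop (by rw [rkN_erase_eq_of_coloop hG hyG hyc]) hS
    have := mem_of_mem_pairPre hG hyG hyc h₁
    have := mem_of_mem_pairPre hG hyG hyc h₂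
    have := mem_of_mem_pairPre hG hyG hyc h₃
    tauto
  have hRc : 3 ≤ R.card := by
    have h1 := Finset.card_sdiff_add_card_inter S ((S \ B₁) ∪ (S \ B₂) ∪ (S \ B₃))
    rw [← hRdef] at h1
    have h2 : (S ∩ ((S \ B₁) ∪ (S \ B₂) ∪ (S \ B₃))).card ≤ 6 := by
      calc (S ∩ ((S \ B₁) ∪ (S \ B₂) ∪ (S \ B₃))).card ≤ ((S \ B₁) ∪ (S \ B₂) ∪ (S \ B₃)).card :=
            Finset.card_le_card Finset.inter_subset_right
        _ ≤ ((S \ B₁) ∪ (S \ B₂)).card + (S \ B₃).card := Finset.card_union_le _ _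
        _ ≤ (S \ B₁).card + (S \ B₂).card + (S \ B₃).card := by
            have := Finset.card_union_le (S \ B₁) (S \ B₂)
            omega
        _ = 6 := by
            rw [card_sdiff_of_mem_pairPre h₁, card_sdiff_of_mem_pairPre h₂, card_sdiff_of_mem_pairPre h₃]
    omega
  have hRe : R.erase y ⊆ G.erase y := Finset.erase_subset_erase _ (Finset.sdiff_subset.trans hSG)
  have hc : 2 ≤ (R.erase y).card := by
    rw [Finset.card_erase_of_mem hyR]
    omega
  have := three_le_rkN_insert_of_two_le_card hGg hyG hyc hsimple hRe hc
  rw [Finset.insert_erase hyR] at this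
  exact this


/-- **Four distinct 2-sets inside `T` with `T ⊆ X₁ ∪ X₂` and `T ⊆ X₁ ∪ X₃` do not exist.** -/
theorem four_pairs_false {T X₁ X₂ X₃ X₄ : Finset α} (hc₁ : X₁.card = 2) (hc₂ : X₂.card = 2) (hc₃ : X₃.card = 2)
    (hc₄ : X₄.card = 2) (hne₁₂ : X₁ ≠ X₂) (hne₁₃ : X₁ ≠ X₃) (hne₁₄ : X₁ ≠ X₄) (hne₂₃ : X₂ ≠ X₃) (hne₂₄ : X₂ ≠ X₄)
    (hne₃₄ : X₃ ≠ X₄) (hT₁ : X₁ ⊆ T) (hT₂ : X₂ ⊆ T) (hT₃ : X₃ ⊆ T) (hT₄ : X₄ ⊆ T) (hT₁₂ : T ⊆ X₁ ∪ X₂)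
    (hT₁₃ : T ⊆ X₁ ∪ X₃) : False := by
  have hTc : T.card ≤ 4 := by
    have := Finset.card_le_card hT₁₂
    have := Finset.card_union_le X₁ X₂
    omega
  -- `T ∖ Xᵢ ⊆ Xⱼ`
  have hsd : ∀ X X' : Finset α, T ⊆ X ∪ X' → T \ X ⊆ X' := by
    intro X X' h e he
    rw [Finset.mem_sdiff] at he
    rcases Finset.mem_union.1 (h he.1) with h' | h'
    · exact absurd h' he.2
    · exact h'
  have hcard : ∀ X : Finset α, X ⊆ T → X.card = 2 → (T \ X).card + 2 = T.card := by
    intro X hX hc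
    have := Finset.card_sdiff_add_card_eq_card hX
    omega
  rcases Nat.lt_or_ge T.card 3 with h2 | h3
  · -- `|T| ≤ 2`: every `Xᵢ` is `T`
    have e₁ : X₁ = T := Finset.eq_of_subset_of_card_le hT₁ (by omega)
    have e₂ : X₂ = T := Finset.eq_of_subset_of_card_le hT₂ (by omega)
    exact hne₁₂ (e₁.trans e₂.symm)
  rcases Nat.lt_or_ge T.card 4 with h3' | h4
  · -- `|T| = 3`: `T ∖ Xᵢ = {tᵢ}` with distinct `tᵢ`
    have hT3 : T.card = 3 := by omega
    have hone : ∀ X : Finset α, X ⊆ T → X.card = 2 → ∃ t, T \ X = {t} := by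
      intro X hX hc
      rw [← Finset.card_eq_one]
      have := hcard X hX hc
      omega
    obtain ⟨t₁, ht₁⟩ := hone X₁ hT₁ hc₁
    obtain ⟨t₂, ht₂⟩ := hone X₂ hT₂ hc₂
    obtain ⟨t₃, ht₃⟩ := hone X₃ hT₃ hc₃
    obtain ⟨t₄, ht₄⟩ := hone X₄ hT₄ hc₄
    -- `Xᵢ = T.erase tᵢ`
    have herase : ∀ X : Finset α, ∀ t, X ⊆ T → X.card = 2 → T \ X = {t} → X = T.erase t := by
      intro X t hX hc hts
      have htT : t ∈ T := (Finset.mem_sdiff.1 (by rw [hts]; exact Finset.mem_singleton_self t)).1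
      have htX : t ∉ X := (Finset.mem_sdiff.1 (by rw [hts]; exact Finset.mem_singleton_self t)).2
      apply Finset.eq_of_subset_of_card_le
      · intro e he
        exact Finset.mem_erase.2 ⟨fun h => htX (h ▸ he), hX he⟩
      · rw [Finset.card_erase_of_mem htT, hT3, hc]
    have e₁ := herase X₁ t₁ hT₁ hc₁ ht₁
    have e₂ := herase X₂ t₂ hT₂ hc₂ ht₂
    have e₃ := herase X₃ t₃ hT₃ hc₃ ht₃
    have e₄ := herase X₄ t₄ hT₄ hc₄ ht₄
    have hd : ∀ X X' : Finset α, ∀ t t', X = T.erase t → X' = T.erase t' → X ≠ X' → t ≠ t' := by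
      intro X X' t t' hX hX' hne htt
      exact hne (by rw [hX, hX', htt])
    have d₁₂ := hd _ _ _ _ e₁ e₂ hne₁₂
    have d₁₃ := hd _ _ _ _ e₁ e₃ hne₁₃
    have d₁₄ := hd _ _ _ _ e₁ e₄ hne₁₄
    have d₂₃ := hd _ _ _ _ e₂ e₃ hne₂₃
    have d₂₄ := hd _ _ _ _ e₂ e₄ hne₂₄
    have d₃₄ := hd _ _ _ _ e₃ e₄ hne₃₄
    have hmem : ∀ X : Finset α, ∀ t, T \ X = {t} → t ∈ T := by
      intro X t hts
      exact (Finset.mem_sdiff.1 (by rw [hts]; exact Finset.mem_singleton_self t)).1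
    have hsub : ({t₁, t₂, t₃, t₄} : Finset α) ⊆ T := by
      intro e he
      simp only [Finset.mem_insert, Finset.mem_singleton] at he
      rcases he with rfl | rfl | rfl | rfl
      · exact hmem X₁ _ ht₁
      · exact hmem X₂ _ ht₂
      · exact hmem X₃ _ ht₃
      · exact hmem X₄ _ ht₄
    have h4 : ({t₁, t₂, t₃, t₄} : Finset α).card = 4 := by
      rw [Finset.card_insert_of_notMem, Finset.card_insert_of_notMem, Finset.card_pair d₃₄]
      · simp only [Finset.mem_insert, Finset.mem_singleton, not_or]
        exact ⟨d₂₃, d₂₄⟩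
      · simp only [Finset.mem_insert, Finset.mem_singleton, not_or]
        exact ⟨d₁₂, d₁₃, d₁₄⟩
    have := Finset.card_le_card hsub
    omega
  · -- `|T| = 4`: `X₂ = T ∖ X₁ = X₃`
    have hT4 : T.card = 4 := by omega
    have e : ∀ X X' : Finset α, X ⊆ T → X.card = 2 → X'.card = 2 → T ⊆ X ∪ X' → X' = T \ X := by
      intro X X' hX hc hc' hTXX'
      symm
      apply Finset.eq_of_subset_of_card_le (hsd X X' hTXX')
      have := hcard X hX hc
      omega
    have e₂ := e X₁ X₂ hT₁ hc₁ hc₂ hT₁₂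
    have e₃ := e X₁ X₃ hT₁ hc₁ hc₃ hT₁₃
    exact hne₂₃ (e₂.trans e₃.symm)

open scoped Classical in
/-- **At most three pair preimages** at a shadow set with `|S| ≥ 9` of the coloop cell (simple matroid). -/
theorem card_pairPre_le_three_of_nine_le {G : Finset α} (hG : G ∈ flatsQ M (4 + 1))
    (hsimple : ∀ e ∈ gr M, ∀ f ∈ gr M, e ≠ f → rkN M {e, f} = 2) {y : α} (hyG : y ∈ G)
    (hyc : y ∉ clF M (G.erase y)) {S : Finset α} (hS : S ∈ shadowAt M (4 + 2) 4 (Uq M (4 + 2) 4) G)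
    (h9 : 9 ≤ S.card) : (pairPre M 4 G S).card ≤ 3 := by
  have hGg : G ⊆ gr M := (mem_flatsQ.1 hG).1
  have hSG : S ⊆ G := subset_of_mem_shadowAt hS
  by_contra hcon
  push Not at hcon
  obtain ⟨B₁, hB₁⟩ : (pairPre M 4 G S).Nonempty := Finset.card_pos.1 (by omega)
  have hcard : 2 < ((pairPre M 4 G S).erase B₁).card := by
    rw [Finset.card_erase_of_mem hB₁]
    omega
  rw [Finset.two_lt_card_iff] at hcard
  obtain ⟨B₂, B₃, B₄, hB₂, hB₃, hB₄, h₂₃, h₂₄, h₃₄⟩ := hcard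
  rw [Finset.mem_erase] at hB₂ hB₃ hB₄
  obtain ⟨h₁₂, hB₂⟩ := hB₂
  obtain ⟨h₁₃, hB₃⟩ := hB₃
  obtain ⟨h₁₄, hB₄⟩ := hB₄
  -- the pair sets and the complements
  have hX : ∀ B ∈ pairPre M 4 G S, ∀ e ∈ S, e ∉ S \ B → e ∈ B := by
    intro B _ e heS heX
    by_contra h
    exact heX (Finset.mem_sdiff.2 ⟨heS, h⟩)
  have hXsub : ∀ B ∈ pairPre M 4 G S, S \ B ⊆ G \ clF M B := fun B hB => sdiff_subset_of_mem_pairPre hB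
  -- `Λ = cl R`, `R = S ∖ (X₁ ∪ X₂ ∪ X₃)`
  set R := S \ ((S \ B₁) ∪ (S \ B₂) ∪ (S \ B₃)) with hRdef
  have hR3 := three_le_rkN_sdiff_three hG hsimple hyG hyc hS h9 hB₁ hB₂ hB₃
  rw [← hRdef] at hR3
  have hRB₁ : R ⊆ B₁ := by
    intro e he
    rw [hRdef, Finset.mem_sdiff, Finset.mem_union, Finset.mem_union] at he
    exact hX B₁ hB₁ e he.1 (fun h => he.2 (Or.inl (Or.inl h)))
  have hRB₂ : R ⊆ B₂ := by
    intro e he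
    rw [hRdef, Finset.mem_sdiff, Finset.mem_union, Finset.mem_union] at he
    exact hX B₂ hB₂ e he.1 (fun h => he.2 (Or.inl (Or.inr h)))
  have hRB₃ : R ⊆ B₃ := by
    intro e he
    rw [hRdef, Finset.mem_sdiff, Finset.mem_union, Finset.mem_union] at he
    exact hX B₃ hB₃ e he.1 (fun h => he.2 (Or.inr h))
  set Λ := clF M R with hΛdef
  have hΛg : Λ ⊆ gr M :=
    (clF_mono hRB₁).trans ((mem_membersIn.1 (mem_pairPre.1 hB₁).1).2.trans hGg)
  -- the intersections among `B₁, B₂, B₃` lie in `Λ`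
  have hI₁₂ : clF M B₁ ∩ clF M B₂ ⊆ Λ := clF_inter_subset_clF_of_three_le hG hB₁ hB₂ h₁₂.symm hRB₁ hRB₂ hR3
  have hI₁₃ : clF M B₁ ∩ clF M B₃ ⊆ Λ := clF_inter_subset_clF_of_three_le hG hB₁ hB₃ h₁₃.symm hRB₁ hRB₃ hR3
  have hI₂₃ : clF M B₂ ∩ clF M B₃ ⊆ Λ := clF_inter_subset_clF_of_three_le hG hB₂ hB₃ h₂₃ hRB₂ hRB₃ hR3
  have hΛ3 : rkN M Λ ≤ 3 := by
    have h0 : rkN M Λ ≤ rkN M R := rkN_le_of_subset_clF' (M := M) (le_refl _)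
    have h1 := rkN_mono (M := M) (Finset.subset_inter (hRB₁.trans (subset_clF (mem_membersIn.1 (mem_pairPre.1 hB₁).1).1))
      (hRB₂.trans (subset_clF (mem_membersIn.1 (mem_pairPre.1 hB₂).1).1)))
    have h2 := rkN_inter_clF_le_three_of_pairPre hG hB₁ hB₂ h₁₂.symm
    omega
  -- a rank-3 subset of `Λ` inside two pair preimages pins their intersection to `Λ`
  have hpin : ∀ B B' : Finset α, B ∈ pairPre M 4 G S → B' ∈ pairPre M 4 G S → B ≠ B' → ∀ R' : Finset α,
      R' ⊆ B → R' ⊆ B' → 3 ≤ rkN M R' → R' ⊆ Λ → clF M B ∩ clF M B' ⊆ Λ ∧ Λ ⊆ clF M B := by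
    intro B B' hB hB' hne R' hR'B hR'B' hR'3 hR'Λ
    have h1 := clF_inter_subset_clF_of_three_le hG hB hB' hne hR'B hR'B' hR'3
    have h2 : clF M R' ⊆ Λ := clF_subset_clF_of_subset_clF hR'Λ
    refine ⟨h1.trans h2, ?_⟩
    -- `Λ ⊆ cl R'` by ranks, and `cl R' ⊆ cl B`
    have hr : rkN M R' = rkN M Λ := by
      have := rkN_mono (M := M) hR'Λ
      omega
    have h3 := subset_closure_of_rkN_eq (M := M) hΛg hR'Λ hr
    intro e he
    have : e ∈ clF M R' := by
      rw [mem_clF_iff]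
      exact h3 (Finset.mem_coe.2 he)
    exact clF_mono hR'B this
  -- `B₄` against `B₁`, `B₂` (via `R₄ = S ∖ (X₁ ∪ X₂ ∪ X₄)`) and against `B₃` (via `R' = S ∖ (X₁ ∪ X₃ ∪ X₄)`)
  have hR₄3 := three_le_rkN_sdiff_three hG hsimple hyG hyc hS h9 hB₁ hB₂ hB₄
  set R₄ := S \ ((S \ B₁) ∪ (S \ B₂) ∪ (S \ B₄)) with hR₄def
  have hR₄B₁ : R₄ ⊆ B₁ := by
    intro e he
    rw [hR₄def, Finset.mem_sdiff, Finset.mem_union, Finset.mem_union] at he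
    exact hX B₁ hB₁ e he.1 (fun h => he.2 (Or.inl (Or.inl h)))
  have hR₄B₂ : R₄ ⊆ B₂ := by
    intro e he
    rw [hR₄def, Finset.mem_sdiff, Finset.mem_union, Finset.mem_union] at he
    exact hX B₂ hB₂ e he.1 (fun h => he.2 (Or.inl (Or.inr h)))
  have hR₄B₄ : R₄ ⊆ B₄ := by
    intro e he
    rw [hR₄def, Finset.mem_sdiff, Finset.mem_union, Finset.mem_union] at he
    exact hX B₄ hB₄ e he.1 (fun h => he.2 (Or.inr h))
  have hR₄Λ : R₄ ⊆ Λ := by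
    intro e he
    apply hI₁₂
    rw [Finset.mem_inter]
    exact ⟨subset_clF (mem_membersIn.1 (mem_pairPre.1 hB₁).1).1 (hR₄B₁ he),
      subset_clF (mem_membersIn.1 (mem_pairPre.1 hB₂).1).1 (hR₄B₂ he)⟩
  obtain ⟨hI₄₁, hΛ₄⟩ := hpin B₄ B₁ hB₄ hB₁ h₁₄ R₄ hR₄B₄ hR₄B₁ hR₄3 hR₄Λ
  have hI₁₄ : clF M B₁ ∩ clF M B₄ ⊆ Λ := by rw [Finset.inter_comm]; exact hI₄₁
  obtain ⟨hI₂₄, -⟩ := hpin B₂ B₄ hB₂ hB₄ h₂₄ R₄ hR₄B₂ hR₄B₄ hR₄3 hR₄Λ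
  have hR'3 := three_le_rkN_sdiff_three hG hsimple hyG hyc hS h9 hB₁ hB₃ hB₄
  set R' := S \ ((S \ B₁) ∪ (S \ B₃) ∪ (S \ B₄)) with hR'def
  have hR'B₁ : R' ⊆ B₁ := by
    intro e he
    rw [hR'def, Finset.mem_sdiff, Finset.mem_union, Finset.mem_union] at he
    exact hX B₁ hB₁ e he.1 (fun h => he.2 (Or.inl (Or.inl h)))
  have hR'B₃ : R' ⊆ B₃ := by
    intro e he
    rw [hR'def, Finset.mem_sdiff, Finset.mem_union, Finset.mem_union] at he
    exact hX B₃ hB₃ e he.1 (fun h => he.2 (Or.inl (Or.inr h)))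
  have hR'B₄ : R' ⊆ B₄ := by
    intro e he
    rw [hR'def, Finset.mem_sdiff, Finset.mem_union, Finset.mem_union] at he
    exact hX B₄ hB₄ e he.1 (fun h => he.2 (Or.inr h))
  have hR'Λ : R' ⊆ Λ := by
    intro e he
    apply hI₁₃
    rw [Finset.mem_inter]
    exact ⟨subset_clF (mem_membersIn.1 (mem_pairPre.1 hB₁).1).1 (hR'B₁ he),
      subset_clF (mem_membersIn.1 (mem_pairPre.1 hB₃).1).1 (hR'B₃ he)⟩
  obtain ⟨hI₃₄, -⟩ := hpin B₃ B₄ hB₃ hB₄ h₃₄ R' hR'B₃ hR'B₄ hR'3 hR'Λ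
  -- `Λ ⊆ cl Bᵢ` for `i = 1, 2, 3` as well
  have hΛ₁ : Λ ⊆ clF M B₁ := clF_mono hRB₁
  have hΛ₂ : Λ ⊆ clF M B₂ := clF_mono hRB₂
  have hΛ₃ : Λ ⊆ clF M B₃ := clF_mono hRB₃
  -- the pair sets live in `T = S ∖ Λ`, and `T ⊆ Xᵢ ∪ Xⱼ`
  set T := S \ Λ with hTdef
  have hXT : ∀ B ∈ pairPre M 4 G S, Λ ⊆ clF M B → S \ B ⊆ T := by
    intro B hB hΛB e he
    rw [hTdef, Finset.mem_sdiff]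
    exact ⟨(Finset.mem_sdiff.1 he).1, fun h => (Finset.mem_sdiff.1 (hXsub B hB he)).2 (hΛB h)⟩
  have hTX : ∀ B B' : Finset α, B ∈ pairPre M 4 G S → B' ∈ pairPre M 4 G S → clF M B ∩ clF M B' ⊆ Λ →
      T ⊆ (S \ B) ∪ (S \ B') := by
    intro B B' hB hB' hI e he
    rw [hTdef, Finset.mem_sdiff] at he
    rw [Finset.mem_union]
    by_contra h
    push Not at h
    apply he.2
    apply hI
    rw [Finset.mem_inter]
    exact ⟨subset_clF (mem_membersIn.1 (mem_pairPre.1 hB).1).1 (hX B hB e he.1 h.1),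
      subset_clF (mem_membersIn.1 (mem_pairPre.1 hB').1).1 (hX B' hB' e he.1 h.2)⟩
  have hT₁ := hXT B₁ hB₁ hΛ₁
  have hT₂ := hXT B₂ hB₂ hΛ₂
  have hT₃ := hXT B₃ hB₃ hΛ₃
  have hT₄ := hXT B₄ hB₄ hΛ₄
  have hc₁ := card_sdiff_of_mem_pairPre hB₁
  have hc₂ := card_sdiff_of_mem_pairPre hB₂
  have hc₃ := card_sdiff_of_mem_pairPre hB₃
  have hc₄ := card_sdiff_of_mem_pairPre hB₄
  have hne₁₂ := sdiff_ne_of_mem_pairPre hB₁ hB₂ h₁₂.symm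
  have hne₁₃ := sdiff_ne_of_mem_pairPre hB₁ hB₃ h₁₃.symm
  have hne₁₄ := sdiff_ne_of_mem_pairPre hB₁ hB₄ h₁₄.symm
  have hne₂₃ := sdiff_ne_of_mem_pairPre hB₂ hB₃ h₂₃
  have hne₂₄ := sdiff_ne_of_mem_pairPre hB₂ hB₄ h₂₄
  have hne₃₄ := sdiff_ne_of_mem_pairPre hB₃ hB₄ h₃₄
  have hT₁₂ := hTX B₁ B₂ hB₁ hB₂ hI₁₂
  have hT₁₃ := hTX B₁ B₃ hB₁ hB₃ hI₁₃
  -- the purely combinatorial contradiction: four distinct 2-subsets of `T` with `T ⊆ X₁ ∪ X₂`, `T ⊆ X₁ ∪ X₃`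
  exact four_pairs_false hc₁ hc₂ hc₃ hc₄ hne₁₂ hne₁₃ hne₁₄ hne₂₃ hne₂₄ hne₃₄ hT₁ hT₂ hT₃ hT₄ hT₁₂ hT₁₃

end PercRepro.Shadow
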